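import Summits.PneNP.PneNP.Theorems.KloostermanAssembly
import Literature.Computability.Cryptography.OneWayFunctionsPneNP

/-!
# BC2 probes (A) — crux `PlantedRootHardness` (stmt-PneNP-2573): every typed piece against `S = PneNP` and `X`

Census companion (prose: `STRATEGY-CENSUS.md`; seams and laws: `StrategyCensus.lean`). Each `example` runs the
instruction's cheap probe `first | exact? | simpa [C] | (unfold C; simpa) | aesop` at 400000 heartbeats, the chain closed
by `| sorry`, so the file elaborates and the number of `sorry` warnings = the number of FAILED probes. Self-contained: section
`Local` re-declares VERBATIM the piece definitions of `StrategyCensus.lean` (definitions only — no seam theorem is visible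
here, so `exact?` sees exactly the landed tree: the route file, its three landed Theorems, `OneWayFunctionsPneNP`).
RESULT (lean check 2026-08-17, farm, wall 193 s): rc 0, 28 sorries = 28 FAILED probes — all of A1–A23 (every piece,
against S and against X), the probe forms C1′ (X → S) and C2′ (W → S), and the converses C4–C6; the by-name controls
C1 (X → S), C2 (W → S), C3 (WeakOWFExist → S) elaborate. NOTE C1/C1′: `X → S` is ONE landed line by name but the cheap
probe does not find it (`exact?` does not look through the `def Assembly : Prop` wrapper of stmt-PneNP-2582) — probe
failure is necessary for clause (c), never sufficient.
-/

set_option linter.dupNamespace false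
set_option linter.unusedVariables false
set_option linter.unusedTactic false
set_option linter.unreachableTactic false

namespace Summit.PneNP.PneNP.Cruxes.PlantedRootHardness.ProbesA

open _root_.Computability Polynomial Filter Finset
open Literature.Computability.Complexity
open Summit.PneNP.PneNP.Theses.Kloosterman

section Local
/-! ### Local verbatim copies of the piece definitions (from `StrategyCensus.lean`) -/

/-- The prime family of the ensemble `D_m`: `m`-subsets of the primes of bit-length `3⌊log₂ m⌋+3`. -/
def fam (m : ℕ) : Finset (Finset ℕ) :=
  ((Finset.Ico (2 ^ (3 * Nat.log 2 m + 2)) (2 ^ (3 * Nat.log 2 m + 3))).filter Nat.Prime).powersetCard m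

/-- The modulus `b = ∏ S`. -/
def modulus (S : Finset ℕ) : ℕ := ∏ p ∈ S, p

/-- The planting bound `c = ⌊b / 2^m⌋`. -/
def bound (S : Finset ℕ) (m : ℕ) : ℕ := (∏ p ∈ S, p) / 2 ^ m

/-- The instance code `⟨code S, ⟨bin a, bin c⟩⟩`. -/
def instCode (S : Finset ℕ) (a c : ℕ) : List Bool :=
  boolPair (encodingListNatBool.encode (S.sort (· ≤ ·))) (boolPair (encodeNat a) (encodeNat c))

/-- The planted instance of `(S, x)` at parameter `m`: `a = x² mod b`, `c = ⌊b/2^m⌋`. -/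
def plantedCode (S : Finset ℕ) (m x : ℕ) : List Bool :=
  instCode S (x ^ 2 % ∏ p ∈ S, p) ((∏ p ∈ S, p) / 2 ^ m)

/-- Success event of X: the output decodes to SOME root of `x²` below `c`. -/
def rootEvent (S : Finset ℕ) (m x : ℕ) : Set (List Bool) :=
  {w | decodeNat w < (∏ p ∈ S, p) / 2 ^ m ∧ decodeNat w ^ 2 ≡ x ^ 2 [MOD ∏ p ∈ S, p]}

/-- The normalised double average of an event family over the ensemble `D_m` (the shape of X's left side). -/
noncomputable def ensembleAvg (B : RandAlg (List Bool) (List Bool)) (m : ℕ)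
    (E : Finset ℕ → ℕ → ℕ → Set (List Bool)) : ℝ :=
  (∑ S ∈ fam m, (∑ x ∈ range (bound S m), B.pr id (plantedCode S m x) (E S m x)) /
    (((bound S m : ℕ)) : ℝ)) / ((fam m).card : ℝ)

/-- A normalised double average of a counting statistic over `D_m` (the shape of the number-theoretic pieces). -/
noncomputable def countAvg (m : ℕ) (M : Finset ℕ → ℕ → Finset ℕ) : ℝ :=
  (∑ S ∈ fam m, ((M S m).card : ℝ) / (((bound S m : ℕ)) : ℝ)) / ((fam m).card : ℝ)

/-- Event of H: the output decodes to a root below `c` other than the planted `x`. -/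
def otherRootEvent (S : Finset ℕ) (m x : ℕ) : Set (List Bool) :=
  {w | decodeNat w < (∏ p ∈ S, p) / 2 ^ m ∧ decodeNat w ≠ x ∧ decodeNat w ^ 2 ≡ x ^ 2 [MOD ∏ p ∈ S, p]}

/-- **H(δ)** `NonPlantedRootHard δ` (hardness piece of the Rabin split). -/
def NonPlantedRootHard (δ : ℝ) : Prop :=
  ∀ B : RandAlg (List Bool) (List Bool),
    B.IsPolyTime (id : List Bool → List Bool) (id : List Bool → List Bool) →
      ∀ᶠ m : ℕ in atTop, ensembleAvg B m otherRootEvent ≤ δ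

/-- The planted points `x < c` whose square has another root below `c`. -/
def multiRoots (S : Finset ℕ) (m : ℕ) : Finset ℕ :=
  (range (bound S m)).filter fun x => ∃ z ∈ range (bound S m), z ≠ x ∧ z ^ 2 ≡ x ^ 2 [MOD ∏ p ∈ S, p]

/-- **N(δ')** `MultiRootLikely δ'` (number-theoretic piece of the Rabin split). -/
def MultiRootLikely (δ' : ℝ) : Prop :=
  ∀ᶠ m : ℕ in atTop, δ' ≤ countAvg m multiRoots

/-- X asserted only along the parameters `m` with `P m`. -/
def XOn (P : ℕ → Prop) : Prop :=
  ∃ q : Polynomial ℕ, (∀ n, 0 < q.eval n) ∧ ∀ B : RandAlg (List Bool) (List Bool),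
    B.IsPolyTime (id : List Bool → List Bool) (id : List Bool → List Bool) →
      ∀ᶠ m : ℕ in atTop, P m → ensembleAvg B m rootEvent ≤ 1 - 1 / ((q.eval m : ℕ) : ℝ)

/-- Census bridge: the number-theoretic census (item #3, open, provable in kind) ⇒ X. Seam = mp (`trivial_seam`).
Fails (d): "census ⇒ hardness against all PPT" has no mechanism (pseudo-solutions are not solutions, so the census has no
information-theoretic content; it bounds lattice ENUMERATION only); and the day #3 lands it IS X (§O2). -/
def CensusBridge : Prop := TernaryPseudoSolutions → PlantedRootHardness

/-- NP-hardness bridge: worst-case NP-hardness of the squarefree slice (item #4, open) ⇒ average-case weak one-wayness.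
Seam = mp. The implication piece is an NP-hardness-to-one-way-function transfer: non-adaptive black-box proofs of it put
`coNP ⊆ AM` (`Literature.Barriers.PneNP.NPHardnessToOneWayFunctions`, AGGM 2006 Thm 4 / Bogdanov–Trevisan 2006); no
random self-reduction in `x` exists (`a ↦ a·u²` destroys smallness); fails (d), and ≡ X once #4 lands (§O2). -/
def NPHardBridge : Prop := SqfreeQCNPHard → PlantedRootHardness

/-- Worst-to-average bridge: `W ⇒ X` (random self-reducibility of small roots — unknown and implausible: the only
multiplicative symmetry `a ↦ a·u²` does not preserve `x < c`). -/
def WorstToAvgBridge : Prop := SqfreeRootSearchHard → PlantedRootHardness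

/-- OWF-universality split: `X ⇐ WeakOWFExist ∧ (WeakOWFExist → X)` ("planted small roots are a universal weak one-way
function", Levin 1987 shape; tree: `LevinUniversalOWF.isWeaklyOneWay_levinUniv_of_OWFExist_holds` for Levin's
ARTIFICIAL function). The implication piece would be the first OWF-completeness theorem for a natural algebraic function
(distribution-preserving reductions into a FIXED ensemble `D_m` — the obstacle of Levin's theory); no plan (d). -/
def OWFUniversality : Prop := Literature.Computability.Cryptography.WeakOWFExist → PlantedRootHardness

/-- Null instance of `(S, y)`, `y` uniform modulo `b`: `a = y² mod b` (a uniform square), same `c`. -/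
def nullCode (S : Finset ℕ) (m y : ℕ) : List Bool :=
  instCode S (y ^ 2 % ∏ p ∈ S, p) ((∏ p ∈ S, p) / 2 ^ m)

/-- Acceptance event of a test with string output: it answers `[true]`. -/
def acceptEvent : Set (List Bool) := {w | w = [true]}

/-- Ensemble-average acceptance of a test on PLANTED instances. -/
noncomputable def plantedAccept (T : RandAlg (List Bool) (List Bool)) (m : ℕ) : ℝ :=
  ensembleAvg T m fun _ _ _ => acceptEvent

/-- Ensemble-average acceptance of a test on NULL instances (inner average over `y < b`). -/
noncomputable def nullAccept (T : RandAlg (List Bool) (List Bool)) (m : ℕ) : ℝ :=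
  (∑ S ∈ fam m, (∑ y ∈ range (∏ p ∈ S, p), T.pr id (nullCode S m y) acceptEvent) / ((∏ p ∈ S, p : ℕ) : ℝ)) /
    ((fam m).card : ℝ)

/-- **D(η)** `PlantedNullIndist η`: no PPT test tells planted squares from uniform squares with advantage `> η`,
eventually (a DECISION hardness piece; the information-theoretic optimum is the small-root-existence test, advantage
`≈ P_null[no root < c] ≈ 1/e`, so `η` must sit below it — a hand-picked threshold, typing checklist (iv)). -/
def PlantedNullIndist (η : ℝ) : Prop :=
  ∀ T : RandAlg (List Bool) (List Bool),
    T.IsPolyTime (id : List Bool → List Bool) (id : List Bool → List Bool) →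
      ∀ᶠ m : ℕ in atTop, plantedAccept T m - nullAccept T m ≤ η

/-- Null points `y < b` whose square has SOME root below `c`. -/
def nullSmallRoot (S : Finset ℕ) (m : ℕ) : Finset ℕ :=
  (range (∏ p ∈ S, p)).filter fun y => ∃ z ∈ range (bound S m), z ^ 2 ≡ y ^ 2 [MOD ∏ p ∈ S, p]

/-- **N₀(π)** `NullRootRare π`: eventually the ensemble-average density of uniform squares having a root below `c` is
`≤ π` (number theory; Poisson heuristics `1 − 1/e`). With D(η), an X-solver of success `> 1 − 1/q` yields the test
"run it, accept iff the output is a root below c" of advantage `≥ 1 − 1/q − π`, contradicting D when `η + π < 1 − 1/q`. -/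
def NullRootRare (π : ℝ) : Prop :=
  ∀ᶠ m : ℕ in atTop,
    (∑ S ∈ fam m, ((nullSmallRoot S m).card : ℝ) / ((∏ p ∈ S, p : ℕ) : ℝ)) / ((fam m).card : ℝ) ≤ π

end Local

/-! ### H = NonPlantedRootHard (Rabin split, hardness piece) -/
set_option maxHeartbeats 400000 in
/-- A1: H → S -/ example : NonPlantedRootHard (1 / 8) → PneNP := by
  first | exact? | simpa [NonPlantedRootHard] | (unfold NonPlantedRootHard; simpa) | (aesop (config := { terminal := true })) | sorry
set_option maxHeartbeats 400000 in
/-- A2: H → X -/ example : NonPlantedRootHard (1 / 8) → PlantedRootHardness := by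
  first | exact? | simpa [NonPlantedRootHard] | (unfold NonPlantedRootHard; simpa) | (aesop (config := { terminal := true })) | sorry

/-! ### N = MultiRootLikely (Rabin split, number-theoretic piece) -/
set_option maxHeartbeats 400000 in
/-- A3: N → S -/ example : MultiRootLikely (1 / 2) → PneNP := by
  first | exact? | simpa [MultiRootLikely] | (unfold MultiRootLikely; simpa) | (aesop (config := { terminal := true })) | sorry
set_option maxHeartbeats 400000 in
/-- A4: N → X -/ example : MultiRootLikely (1 / 2) → PlantedRootHardness := by
  first | exact? | simpa [MultiRootLikely] | (unfold MultiRootLikely; simpa) | (aesop (config := { terminal := true })) | sorry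

/-! ### D = PlantedNullIndist, N₀ = NullRootRare (decision split) -/
set_option maxHeartbeats 400000 in
/-- A5: D → S -/ example : PlantedNullIndist (1 / 5) → PneNP := by
  first | exact? | simpa [PlantedNullIndist] | (unfold PlantedNullIndist; simpa) | (aesop (config := { terminal := true })) | sorry
set_option maxHeartbeats 400000 in
/-- A6: D → X -/ example : PlantedNullIndist (1 / 5) → PlantedRootHardness := by
  first | exact? | simpa [PlantedNullIndist] | (unfold PlantedNullIndist; simpa) | (aesop (config := { terminal := true })) | sorry
set_option maxHeartbeats 400000 in
/-- A7: N₀ → S -/ example : NullRootRare (7 / 10) → PneNP := by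
  first | exact? | simpa [NullRootRare] | (unfold NullRootRare; simpa) | (aesop (config := { terminal := true })) | sorry
set_option maxHeartbeats 400000 in
/-- A8: N₀ → X -/ example : NullRootRare (7 / 10) → PlantedRootHardness := by
  first | exact? | simpa [NullRootRare] | (unfold NullRootRare; simpa) | (aesop (config := { terminal := true })) | sorry

/-! ### Bridge splits: the implication pieces and their partners -/
set_option maxHeartbeats 400000 in
/-- A9: CensusBridge → S -/ example : CensusBridge → PneNP := by
  first | exact? | simpa [CensusBridge] | (unfold CensusBridge; simpa) | (aesop (config := { terminal := true })) | sorry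
set_option maxHeartbeats 400000 in
/-- A10: CensusBridge → X -/ example : CensusBridge → PlantedRootHardness := by
  first | exact? | simpa [CensusBridge] | (unfold CensusBridge; simpa) | (aesop (config := { terminal := true })) | sorry
set_option maxHeartbeats 400000 in
/-- A11: T (item #3) → S -/ example : TernaryPseudoSolutions → PneNP := by
  first | exact? | simpa [TernaryPseudoSolutions] | (unfold TernaryPseudoSolutions; simpa) | (aesop (config := { terminal := true })) | sorry
set_option maxHeartbeats 400000 in
/-- A12: T (item #3) → X -/ example : TernaryPseudoSolutions → PlantedRootHardness := by
  first | exact? | simpa [TernaryPseudoSolutions] | (unfold TernaryPseudoSolutions; simpa) | (aesop (config := { terminal := true })) | sorry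
set_option maxHeartbeats 400000 in
/-- A13: NPHardBridge → S -/ example : NPHardBridge → PneNP := by
  first | exact? | simpa [NPHardBridge] | (unfold NPHardBridge; simpa) | (aesop (config := { terminal := true })) | sorry
set_option maxHeartbeats 400000 in
/-- A14: NPHardBridge → X -/ example : NPHardBridge → PlantedRootHardness := by
  first | exact? | simpa [NPHardBridge] | (unfold NPHardBridge; simpa) | (aesop (config := { terminal := true })) | sorry
set_option maxHeartbeats 400000 in
/-- A15: item #4 → S -/ example : SqfreeQCNPHard → PneNP := by
  first | exact? | simpa [SqfreeQCNPHard] | (unfold SqfreeQCNPHard; simpa) | (aesop (config := { terminal := true })) | sorry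
set_option maxHeartbeats 400000 in
/-- A16: item #4 → X -/ example : SqfreeQCNPHard → PlantedRootHardness := by
  first | exact? | simpa [SqfreeQCNPHard] | (unfold SqfreeQCNPHard; simpa) | (aesop (config := { terminal := true })) | sorry
set_option maxHeartbeats 400000 in
/-- A17: WorstToAvgBridge → S -/ example : WorstToAvgBridge → PneNP := by
  first | exact? | simpa [WorstToAvgBridge] | (unfold WorstToAvgBridge; simpa) | (aesop (config := { terminal := true })) | sorry
set_option maxHeartbeats 400000 in
/-- A18: WorstToAvgBridge → X -/ example : WorstToAvgBridge → PlantedRootHardness := by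
  first | exact? | simpa [WorstToAvgBridge] | (unfold WorstToAvgBridge; simpa) | (aesop (config := { terminal := true })) | sorry
set_option maxHeartbeats 400000 in
/-- A19: OWFUniversality → S -/ example : OWFUniversality → PneNP := by
  first | exact? | simpa [OWFUniversality] | (unfold OWFUniversality; simpa) | (aesop (config := { terminal := true })) | sorry
set_option maxHeartbeats 400000 in
/-- A20: OWFUniversality → X -/ example : OWFUniversality → PlantedRootHardness := by
  first | exact? | simpa [OWFUniversality] | (unfold OWFUniversality; simpa) | (aesop (config := { terminal := true })) | sorry

/-! ### Index slices (costume) -/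
set_option maxHeartbeats 400000 in
/-- A21: X|_even → S -/ example : XOn (fun m => Even m) → PneNP := by
  first | exact? | simpa [XOn] | (unfold XOn; simpa) | (aesop (config := { terminal := true })) | sorry
set_option maxHeartbeats 400000 in
/-- A22: X|_even → X -/ example : XOn (fun m => Even m) → PlantedRootHardness := by
  first | exact? | simpa [XOn] | (unfold XOn; simpa) | (aesop (config := { terminal := true })) | sorry
set_option maxHeartbeats 400000 in
/-- A23: X|_odd → X -/ example : XOn (fun m => ¬ Even m) → PlantedRootHardness := by
  first | exact? | simpa [XOn] | (unfold XOn; simpa) | (aesop (config := { terminal := true })) | sorry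

/-! ### Controls (expected SUCCESS by name) and converses (expected failure) -/
/-- C1: X → S by name (the RESTATED signal: landed Assembly stmt-PneNP-2582). -/
example : PlantedRootHardness → PneNP := Summit.PneNP.PneNP.Theorems.kloosterman_assembly_proof
set_option maxHeartbeats 400000 in
/-- C1': X → S by the probe (does `exact?` see through the `Assembly` wrapper?). -/
example : PlantedRootHardness → PneNP := by
  first | exact? | simpa [PlantedRootHardness] | (unfold PlantedRootHardness; simpa) | (aesop (config := { terminal := true })) | sorry
/-- C2: W → S by name (landed glue stmt-PneNP-2579): the worst-case partner gives S alone. -/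
example : SqfreeRootSearchHard → PneNP := Summit.PneNP.PneNP.Theorems.kloosterman_worstCaseToSummit_proof
set_option maxHeartbeats 400000 in
/-- C2': W → S by the probe. -/
example : SqfreeRootSearchHard → PneNP := by
  first | exact? | simpa [SqfreeRootSearchHard] | (unfold SqfreeRootSearchHard; simpa) | (aesop (config := { terminal := true })) | sorry
/-- C3: WeakOWFExist → S by name (landed `pneNP_shape_of_WeakOWFExist`): the OWF partner gives S alone. -/
example : Literature.Computability.Cryptography.WeakOWFExist → PneNP :=
  fun h => Literature.Computability.Cryptography.pneNP_shape_of_WeakOWFExist h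
set_option maxHeartbeats 400000 in
/-- C4: S → X (converse; expected to FAIL: S is existential, X the stronger-looking statement). -/
example : PneNP → PlantedRootHardness := by
  first | exact? | simpa [PlantedRootHardness] | (unfold PlantedRootHardness; simpa) | (aesop (config := { terminal := true })) | sorry
set_option maxHeartbeats 400000 in
/-- C5: X → H (expected to FAIL: H is not a consequence of X). -/
example : PlantedRootHardness → NonPlantedRootHard (1 / 8) := by
  first | exact? | simpa [NonPlantedRootHard] | (unfold NonPlantedRootHard; simpa) | (aesop (config := { terminal := true })) | sorry
set_option maxHeartbeats 400000 in
/-- C6: X → N (expected to FAIL). -/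
example : PlantedRootHardness → MultiRootLikely (1 / 2) := by
  first | exact? | simpa [MultiRootLikely] | (unfold MultiRootLikely; simpa) | (aesop (config := { terminal := true })) | sorry

end Summit.PneNP.PneNP.Cruxes.PlantedRootHardness.ProbesA
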